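import Literature.InformationTheory.QuantumCodes.GoodQLDPCLemmas
import Literature.InformationTheory.QuantumCodes.HypergraphProductParameters
import Literature.InformationTheory.QuantumCodes.HypergraphProductKernels
import Literature.InformationTheory.QuantumCodes.HypergraphProductSectorDistances
import Literature.InformationTheory.QuantumCodes.HypergraphProductWeights
import Literature.InformationTheory.Coding.GoodLDPCCodesExist
import Mathlib.LinearAlgebra.FiniteDimensional.Lemmas
import HarnessLib

/-!
# Tillich–Zémor 2014: quantum LDPC codes with positive rate and distance `∝ √N` EXIST — the named fact
# `TillichZemor2014_hgp_sqrt_distance` of `GoodQLDPC.lean` DISCHARGED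

`GoodQLDPC.lean` (QEC ladder row type-07) typed the existence sentence of Tillich–Zémor, IEEE TIT 60 (2014) =
arXiv:0903.0566, Abstract + Theorem 1 — "any family of classical asymptotically good LDPC codes of fixed rate yields
a family of quantum LDPC codes of fixed rate and minimum distance proportional to a square root of the block length"
— as the named fact `TillichZemor2014_hgp_sqrt_distance : Prop` (`∃ w R c > 0, ∀ N₀, ∃ N ≥ N₀`, a `w`-limited CSS
pair over `𝔽₂` of length `N` with `k ≥ R·N`, `d ≥ c·√N`). This file PROVES it (`TillichZemor2014_hgp_sqrt_distance_holds`),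
unconditionally, by composing three proved ingredients of the tree:

1. classical asymptotically good LDPC codes exist (`Coding.exists_goodLDPCMatrix`, `Coding/GoodLDPCCodesExist.lean`:
   Gallager's ensemble via Sipser–Spielman unique-neighbour expansion — full-rank `r × 2n` binary `H`, `8r ≤ 15n`,
   row weights `≤ 8`, column weights `≤ 4`, non-zero kernel words of weight `> n/650`);
2. Tillich–Zémor's Theorem 1 for the product of `H` with `Hᵀ` (`HypergraphProduct.mainTheorem_holds`, row type-04:
   length `N = (2n)² + r²`, dimension `(2n − r)²`, minimum distance `= d(ker H)`);
3. the row/column weights of the product matrices (`HypergraphProductWeights.lean`, TZ §4: `≤ 8 + 4 = 12`),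
   and invariance of all parameters under re-indexing the qubits/checks by `Fin` types (`IsQLDPCCodeWith.reindex`).

With `8r ≤ 15n`: `N ≤ 4n² + (15n/8)² < 8n²`, `k = (2n−r)² ≥ n²/64 ≥ N/512` and `d > n/650 ≥ √N/2000`; so the fact holds
with `w = 12`, `R = 1/512`, `c = 1/2000` (this proof's constants; the paper's Theorem 1 gives `[[n²+(n−k)², k², d]]`
from any `[n,k,d]` code with full-rank `H`).

References: J.-P. Tillich, G. Zémor, IEEE Trans. Inform. Theory 60 (2014) 1193–1202 = arXiv:0903.0566v1, Abstract
(chunk p0002 L1–8), Theorem 1 (chunk p0003 L71–82), §4 (chunk p0007 L25–45), §6 Remark (chunk p0009 L53–58);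
R. G. Gallager, *Low-Density Parity-Check Codes* (MIT Press 1963), Ch. 2.
-/

namespace Literature.InformationTheory.QuantumCodes

open Matrix Finset HypergraphProduct

/-! ### Re-indexing a CSS pair does not change its parameters -/

section Reindex

variable {F : Type*} [Field F] [DecidableEq F]
variable {RX RZ Q RX' RZ' Q' : Type*} [Fintype RX] [Fintype RZ] [Fintype Q] [Fintype RX'] [Fintype RZ']
  [Fintype Q']

/-- The CSS minimum distance is unchanged by re-indexing checks and qubits along equivalences.
[cite: TillichZemor2014, §2 (arXiv:0903.0566v1 chunk p0004 L9-18: the distance depends only on the two check spaces)] -/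
theorem cssMinDist_reindex (HX : Matrix RX Q F) (HZ : Matrix RZ Q F) (eX : RX ≃ RX') (eZ : RZ ≃ RZ')
    (eQ : Q ≃ Q') : cssMinDist (reindex eX eQ HX) (reindex eZ eQ HZ) = cssMinDist HX HZ := by
  rw [reindex_apply, reindex_apply,
    show HX.submatrix eX.symm eQ.symm = (HX.submatrix eX.symm id).submatrix id eQ.symm from rfl,
    show HZ.submatrix eZ.symm eQ.symm = (HZ.submatrix eZ.symm id).submatrix id eQ.symm from rfl,
    cssMinDist_submatrix_equiv, cssMinDist_submatrix_equiv_rows]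

/-- **Re-indexing invariance of the parameter predicate.** A `w`-limited CSS pair with `k ≥ K`, `d ≥ D` stays one
after re-indexing the `X`-checks, the `Z`-checks and the qudits along equivalences (the CSS condition, all row and
column weights, `n − rk H_X − rk H_Z` and the minimum distance are invariant).
[cite: TillichZemor2014, §2 and §4 (arXiv:0903.0566v1 chunks p0004 L9-18, p0007 L25-45)] -/
theorem IsQLDPCCodeWith.reindex {HX : Matrix RX Q F} {HZ : Matrix RZ Q F} {w : ℕ} {K D : ℝ}
    (h : IsQLDPCCodeWith HX HZ w K D) (eX : RX ≃ RX') (eZ : RZ ≃ RZ') (eQ : Q ≃ Q') :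
    IsQLDPCCodeWith (Matrix.reindex eX eQ HX) (Matrix.reindex eZ eQ HZ) w K D where
  comm := by
    rw [reindex_apply, reindex_apply, transpose_submatrix, submatrix_mul_equiv, h.comm]
    rfl
  rowX_le i := by
    have := hammingNorm_comp_equiv (HX (eX.symm i)) eQ
    rw [reindex_apply]
    exact (le_of_eq this).trans (h.rowX_le _)
  colX_le j := by
    have := hammingNorm_comp_equiv (fun i => HX i (eQ.symm j)) eX
    rw [reindex_apply]
    exact (le_of_eq this).trans (h.colX_le _)
  rowZ_le i := by
    have := hammingNorm_comp_equiv (HZ (eZ.symm i)) eQ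
    rw [reindex_apply]
    exact (le_of_eq this).trans (h.rowZ_le _)
  colZ_le j := by
    have := hammingNorm_comp_equiv (fun i => HZ i (eQ.symm j)) eZ
    rw [reindex_apply]
    exact (le_of_eq this).trans (h.colZ_le _)
  le_dim := by
    rw [rank_reindex, rank_reindex, Fintype.card_congr eQ.symm]
    exact h.le_dim
  ceil_le_cssMinDist := by
    rw [cssMinDist_reindex]
    exact h.ceil_le_cssMinDist

end Reindex

/-! ### The hypergraph product of a good classical LDPC matrix with its transpose -/

section HGP

/-- Rank–nullity for a parity-check matrix: `dim ker H + rank H = n`.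
[cite: TillichZemor2014, Thm 1 (arXiv:0903.0566v1 chunk p0003 L71-80: an `(n−k)×n` full-rank parity-check matrix of an `[n,k,d]` code)] -/
theorem finrank_pcCode_add_rank {r m : ℕ} (H : Matrix (Fin r) (Fin m) (ZMod 2)) :
    Module.finrank (ZMod 2) (pcCode H) + H.rank = m := by
  have h := LinearMap.finrank_range_add_finrank_ker H.mulVecLin
  rw [Module.finrank_fin_fun] at h
  calc Module.finrank (ZMod 2) (pcCode H) + H.rank
      = Module.finrank (ZMod 2) (LinearMap.ker H.mulVecLin) + Module.finrank (ZMod 2) (LinearMap.range H.mulVecLin) :=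
        rfl
    _ = m := by rw [add_comm]; exact h

/-- **The product code of a bounded-weight classical matrix is LDPC with the Tillich–Zémor parameters.** For a
full-rank binary `r × m` matrix `H` with row weights `≤ a`, column weights `≤ b`, and every non-zero kernel word of
weight `≥ D` (`D` real), the CSS pair `(H_X, H_Z) = (xMatrix H Hᵀ, zMatrix H Hᵀ)` on `N = m² + r²` qubits is
`(a+b)`-limited with `k ≥ (m − r)²` and `d ≥ D` — Theorem 1 of Tillich–Zémor together with the §4 weight count.
[cite: TillichZemor2014, Thm 1 (arXiv:0903.0566v1 chunk p0003 L71-82) and §4 (chunk p0007 L25-45)] -/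
theorem isQLDPCCodeWith_hgp_transpose {r m : ℕ} (H : Matrix (Fin r) (Fin m) (ZMod 2)) (hrank : H.rank = r)
    {a b : ℕ} (hrow : ∀ i, hammingNorm (H i) ≤ a) (hcol : ∀ j, hammingNorm (fun i => H i j) ≤ b) {D : ℝ}
    (hD : ∀ v : Fin m → ZMod 2, H *ᵥ v = 0 → v ≠ 0 → D ≤ hammingNorm v) :
    IsQLDPCCodeWith (xMatrix H Hᵀ) (zMatrix H Hᵀ) (a + b) (((m : ℝ) - r) ^ 2) D := by
  classical
  obtain ⟨hdim, hd⟩ := mainTheorem_holds r m H hrank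
  refine ⟨xMatrix_mul_zMatrix_transpose H Hᵀ, fun i => ?_, fun j => ?_, fun i => ?_, fun j => ?_, ?_, ?_⟩
  · obtain ⟨x, y⟩ := i
    calc hammingNorm (xMatrix H Hᵀ (x, y)) ≤ hammingNorm (H x) + hammingNorm (Hᵀ y) :=
          hammingNorm_xMatrix_row_le H Hᵀ x y
      _ ≤ a + b := add_le_add (hrow x) (hcol y)
  · rcases j with ⟨α, y⟩ | ⟨x, β⟩
    · exact (hammingNorm_xMatrix_col_inl_le H Hᵀ α y).trans ((hcol α).trans (Nat.le_add_left _ _))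
    · calc hammingNorm (fun v => xMatrix H Hᵀ v (Sum.inr (x, β))) ≤ hammingNorm (fun y => Hᵀ y β) :=
            hammingNorm_xMatrix_col_inr_le H Hᵀ x β
        _ ≤ a + b := (hrow β).trans (Nat.le_add_right _ _)
  · obtain ⟨α, β⟩ := i
    calc hammingNorm (zMatrix H Hᵀ (α, β)) ≤ hammingNorm (fun x => H x α) + hammingNorm (fun y => Hᵀ y β) :=
          hammingNorm_zMatrix_row_le H Hᵀ α β
      _ ≤ b + a := add_le_add (hcol α) (hrow β)
      _ = a + b := add_comm _ _
  · rcases j with ⟨α, y⟩ | ⟨x, β⟩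
    · calc hammingNorm (fun c => zMatrix H Hᵀ c (Sum.inl (α, y))) ≤ hammingNorm (Hᵀ y) :=
            hammingNorm_zMatrix_col_inl_le H Hᵀ α y
        _ ≤ a + b := (hcol y).trans (Nat.le_add_left _ _)
    · exact (hammingNorm_zMatrix_col_inr_le H Hᵀ x β).trans ((hrow x).trans (Nat.le_add_right _ _))
  · -- dimension: `N − rk H_X − rk H_Z = (dim ker H)² = (m − r)²`
    have hk : (Module.finrank (ZMod 2) (pcCode H) : ℝ) = (m : ℝ) - r := by
      have := finrank_pcCode_add_rank H
      rw [hrank] at this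
      have h' : ((Module.finrank (ZMod 2) (pcCode H) + r : ℕ) : ℝ) = m := by exact_mod_cast this
      push_cast at h'
      linarith
    have hdimR : ((Fintype.card ((Fin m × Fin m) ⊕ (Fin r × Fin r)) : ℝ)) - (xMatrix H Hᵀ).rank
        - (zMatrix H Hᵀ).rank = (Module.finrank (ZMod 2) (pcCode H) : ℝ) ^ 2 := by
      exact_mod_cast hdim
    rw [hdimR, hk]
  · -- distance: `⌈D⌉ ≤ cssMinDist = d(ker H)`
    rw [hd]
    refine Coding.le_minDist_iff.2 fun v hv hv0 => ?_
    exact_mod_cast Nat.ceil_le.2 (hD v hv hv0)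

end HGP

/-! ### The named fact, proved -/

/-- **Tillich–Zémor 2014 (Abstract + Theorem 1), PROVED: quantum LDPC codes of fixed positive rate with minimum
distance proportional to the square root of the block length exist.** Discharge of the named fact
`TillichZemor2014_hgp_sqrt_distance` of `GoodQLDPC.lean`, with the constants `w = 12`, `R = 1/512`, `c = 1/2000`:
for every `N₀` there is a `12`-limited CSS pair over `𝔽₂` of some length `N ≥ N₀` with `k ≥ N/512` and
`d ≥ √N/2000`. Construction: the hypergraph product (TZ Thm 1, `HypergraphProduct.mainTheorem_holds`) of a classical
asymptotically good LDPC matrix (`Coding.exists_goodLDPCMatrix`: Gallager 1963 / Sipser–Spielman 1996, proved in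
the tree) with its transpose, re-indexed by `Fin` types.
[cite: TillichZemor2014, Abstract and Thm 1 (arXiv:0903.0566v1 chunk p0002 L1-8, chunk p0003 L71-82)] -/
theorem TillichZemor2014_hgp_sqrt_distance_holds : TillichZemor2014_hgp_sqrt_distance := by
  classical
  refine ⟨12, 1 / 512, 1 / 2000, by norm_num, by norm_num, fun N₀ => ?_⟩
  -- a good classical LDPC matrix of length `2n`, `n = max N₀ 1`
  set n : ℕ := max N₀ 1 with hn
  have hn1 : 1 ≤ n := le_max_right _ _
  obtain ⟨r, H, hrank, hr, hrow, hcol, hdist⟩ := Coding.exists_goodLDPCMatrix hn1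
  -- the product code on `Q = (Fin 2n × Fin 2n) ⊕ (Fin r × Fin r)`, `N = 4n² + r²` qubits
  set N : ℕ := Fintype.card ((Fin (2 * n) × Fin (2 * n)) ⊕ (Fin r × Fin r)) with hNdef
  have hNeq : N = (2 * n) ^ 2 + r ^ 2 := by
    rw [hNdef, Fintype.card_sum, Fintype.card_prod, Fintype.card_prod, Fintype.card_fin, Fintype.card_fin]; ring
  -- real-number bookkeeping
  have hnR : (1 : ℝ) ≤ n := by exact_mod_cast hn1
  have hrR : 8 * (r : ℝ) ≤ 15 * n := by exact_mod_cast hr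
  have hNR : (N : ℝ) = (2 * n) ^ 2 + (r : ℝ) ^ 2 := by rw [hNeq]; push_cast; ring
  have hN9 : (N : ℝ) ≤ (3 * n) ^ 2 := by rw [hNR]; nlinarith
  -- the base parameters: weights `8 + 4`, dimension `(2n − r)²`, distance `> n/650`
  have hbase := isQLDPCCodeWith_hgp_transpose H hrank hrow hcol (D := (1 / 2000 : ℝ) * Real.sqrt N)
    (fun v hv hv0 => by
      have h1 : n / 650 < hammingNorm v := hdist v hv hv0
      -- `√N/2000 ≤ 3n/2000 ≤ n/650 < ⌊n/650⌋ + 1 ≤ wt v`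
      have h2 : Real.sqrt N ≤ 3 * n := by
        rw [← Real.sqrt_sq (by positivity : (0 : ℝ) ≤ 3 * n)]
        exact Real.sqrt_le_sqrt hN9
      have h3 : ((n : ℝ) / 650) < (n / 650 : ℕ) + 1 := by
        have := Nat.lt_div_mul_add (a := n) (b := 650) (by norm_num)
        have h' : (n : ℝ) < ((n / 650 * 650 + 650 : ℕ) : ℝ) := by exact_mod_cast this
        push_cast at h'
        linarith
      have h4 : ((n / 650 : ℕ) : ℝ) + 1 ≤ hammingNorm v := by exact_mod_cast h1
      linarith)
  refine ⟨N, ?_, Fintype.card (Fin r × Fin (2 * n)), Fintype.card (Fin (2 * n) × Fin r),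
    Matrix.reindex (Fintype.equivFin _) (Fintype.equivFin _) (xMatrix H Hᵀ),
    Matrix.reindex (Fintype.equivFin _) (Fintype.equivFin _) (zMatrix H Hᵀ), ?_⟩
  · -- `N₀ ≤ n ≤ 4n² ≤ N`
    have : N₀ ≤ n := le_max_left _ _
    rw [hNeq]; nlinarith
  · refine (IsQLDPCCodeWith.mono hbase (le_refl _) ?_ (le_refl _)).reindex _ _ _
    -- `N/512 ≤ (2n − r)²`
    rw [hNR]
    push_cast
    nlinarith

end Literature.InformationTheory.QuantumCodes
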